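import Mathlib
import HarnessLib
import Summits.Ventures.LatticeQCDFlow.Exactness.SphereLOMapTransportDefect

/-!
# Engel–Schaefer's leading-order flow is trivializing to second order: `|⟨H⟩_{e^{−cS}π̄/Z_c} − ∫H∘Φ_c dπ̄| ≤ (c²/2)·sup|H|·sup V₀ ≤ (c²/2)·sup|H|·(2κ²/(d−1))·Σ_n(Σ_m‖U_nm‖)²`

HONEST FRAMING: exact (Metropolis-corrected) sampling algorithms for lattice gauge theory;
figures of merit are autocorrelation/cost numbers at stated couplings and volumes; no
continuum-physics claim.

Venture `LatticeQCDFlow` (cell pub-lqcd), topic `Exactness`; FANOUT row 7 (`s0-cpn-null`: the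
S0-D1 rung — 2D CP⁹, β ∈ [0.7, 1.0], Lüscher's LO trivializing map inside HMC, Engel–Schaefer
2011).  NEW WORK of the cell over the tree's `Exactness/SphereLOMapTransportDefect.lean` (this
leg: the LO covariance law `(d/ds)⟨H∘Φ_{c−s}⟩_s = s·Cov_s(H∘Φ_{c−s}, V₀)`, `0 ≤ V₀ ≤
(2κ²/(d−1))Σ_n(Σ_m‖U_nm‖)²`), `Exactness/SphereLuscherFiniteTimeUniqueness.lean` (`0 < ∫e^{−sS}dπ̄`)
and Mathlib (`antitoneOn_of_hasDerivWithinAt_nonpos`, `monotoneOn_of_hasDerivWithinAt_nonneg`,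
`norm_integral_le_of_norm_le`); nothing is cited as a fact.  Printed counterpart, NAMED ONLY:
M. Lüscher, Commun. Math. Phys. 293 (2010) 899, §4.3 (quality of truncated trivializing maps);
Engel–Schaefer, Comput. Phys. Commun. 182 (2011) 2107, §3 (the LO map run by the rung).

For `S = esAction κ S₀ U` (no self-coupling, adjoint pairs, `d = dim E ≥ 2`) and its leading-order
flow `Φ` (the sphere gradient flow of `S̃⁽⁰⁾`):

* §1 **`|Cov_s(K, V)| ≤ M_K·M_V`** (**`abs_tiltedCov_le`**): a tilted covariance
  `∫wKV/∫w − (∫wK/∫w)(∫wV/∫w)`, `w = e^{−sS}`, of continuous `K`, `V` on `Ω` with `|K| ≤ M_K`,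
  `0 ≤ V ≤ M_V` is at most `M_K·M_V` in absolute value (`Cov = ∫wK(V − V̄)/∫w`, `|V − V̄| ≤ M_V`).
* §2 **THE SECOND-ORDER DEFECT BOUND** (**`abs_tiltedMean_sub_integral_comp_loFlow_le`**): for
  `0 ≤ c`, every `C¹` observable with `|H| ≤ M_H` on `Ω` and every bound `V₀ ≤ M_V` on `Ω`
  (`V₀ = (2κ²/(d−1))Σ_n‖p_n‖²`),
  `|∫e^{−cS}H dπ̄/∫e^{−cS}dπ̄ − ∫H(Φ_c ω)dπ̄(ω)| ≤ (c²/2)·M_H·M_V`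
  (the tilted mean `g(s) = ⟨H∘Φ_{c−s}⟩_s` has `g′(s) = s·Cov_s` with `|Cov_s| ≤ M_HM_V`, so
  `g(s) ∓ (M_HM_V/2)s²` are monotone on `[0, c]`; `g(c) = ⟨H⟩_c`, `g(0) = ∫H∘Φ_c dπ̄`), and with the
  explicit volume bound (**`abs_tiltedMean_sub_integral_comp_loFlow_le_volume`**):
  `≤ (c²/2)·M_H·(2κ²/(d−1))·Σ_n(Σ_m‖U_nm‖)²` — USING E–S's LO FLOW AT FLOW TIME `c` AS AN
  UNCORRECTED TRIVIALIZING MAP BIASES TILTED EXPECTATIONS BY AT MOST `O(c²·|Λ|)` WITH AN EXPLICIT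
  CONSTANT (for unit-norm nearest-neighbour transporters with coordination number `z` the last
  factor is `z²|Λ|`).  The rung removes this bias exactly by the HMC accept/reject step; the bound
  quantifies what the LO map leaves for the correction to do.

NOT CLAIMED: anything about the Euler-discretised map actually run by the rung (this is the exact
LO flow); sharpness of the constant; the variance of the residual action (which governs the
acceptance rate) — only the bias of uncorrected expectations; NLO/NNLO maps; anything about
autocorrelations or the rung's numbers.
-/

noncomputable section

namespace Summit.Ventures.LatticeQCDFlow.Exactness

open Function Set Metric MeasureTheory NormedSpace InnerProductSpace
open scoped RealInnerProductSpace Topology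

variable {Λ : Type*} {E : Type*} [NormedAddCommGroup E] [InnerProductSpace ℝ E]
  [FiniteDimensional ℝ E] [Fintype Λ] [DecidableEq Λ]

/-! ## §1 A tilted covariance bound, §2 the second-order defect -/

section Defect

variable [MeasurableSpace E] [BorelSpace E] [Nontrivial E] {U : Λ → Λ → (E →L[ℝ] E)}

omit [DecidableEq Λ] in
/-- **A tilted covariance is bounded by the product of the sup bounds**: for a continuous
action `S`, continuous `K`, `V` on `Ω` with `|K| ≤ M_K` and `0 ≤ V ≤ M_V`, and the weight
`w = e^{−sS}`: `|∫wKV/∫w − (∫wK/∫w)·(∫wV/∫w)| ≤ M_K·M_V`. -/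
theorem abs_tiltedCov_le {S : (Λ → E) → ℝ} (hS : Continuous S) (s : ℝ)
    {K V : (Λ → sphere (0 : E) 1) → ℝ} (hK : Continuous K) (hV : Continuous V) {MK MV : ℝ}
    (hKb : ∀ ω, |K ω| ≤ MK) (hV0 : ∀ ω, 0 ≤ V ω) (hVb : ∀ ω, V ω ≤ MV) :
    |(∫ ω, Real.exp (-(s * S (fun m => ((ω : Λ → sphere (0 : E) 1) m : E)))) * K ω * V ω
          ∂Measure.pi (fun _ : Λ => uniformSphere (volume : Measure E))) /
          (∫ ω, Real.exp (-(s * S (fun m => ((ω : Λ → sphere (0 : E) 1) m : E))))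
            ∂Measure.pi (fun _ : Λ => uniformSphere (volume : Measure E))) -
        (∫ ω, Real.exp (-(s * S (fun m => ((ω : Λ → sphere (0 : E) 1) m : E)))) * K ω
            ∂Measure.pi (fun _ : Λ => uniformSphere (volume : Measure E))) /
            (∫ ω, Real.exp (-(s * S (fun m => ((ω : Λ → sphere (0 : E) 1) m : E))))
              ∂Measure.pi (fun _ : Λ => uniformSphere (volume : Measure E))) *
          ((∫ ω, Real.exp (-(s * S (fun m => ((ω : Λ → sphere (0 : E) 1) m : E)))) * V ω
              ∂Measure.pi (fun _ : Λ => uniformSphere (volume : Measure E))) /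
            ∫ ω, Real.exp (-(s * S (fun m => ((ω : Λ → sphere (0 : E) 1) m : E))))
              ∂Measure.pi (fun _ : Λ => uniformSphere (volume : Measure E)))| ≤
      MK * MV := by
  have hw : Continuous fun ω : Λ → sphere (0 : E) 1 => Real.exp (-(s * S (fun m => (ω m : E)))) :=
    continuous_exp_neg_mul_sphereConfig hS s
  have hwpos : ∀ ω : Λ → sphere (0 : E) 1, 0 < Real.exp (-(s * S (fun m => (ω m : E)))) := fun ω =>
    Real.exp_pos _
  have hiw : Integrable (fun ω : Λ → sphere (0 : E) 1 => Real.exp (-(s * S (fun m => (ω m : E)))))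
      (Measure.pi fun _ : Λ => uniformSphere (volume : Measure E)) := integrable_pi_of_continuous _ hw
  have hZ := integral_exp_neg_mul_pos (Λ := Λ) (E := E) hS s
  -- the tilted mean of V lies in [0, MV]
  have hVbar0 : 0 ≤ (∫ ω, Real.exp (-(s * S (fun m => ((ω : Λ → sphere (0 : E) 1) m : E)))) * V ω
      ∂Measure.pi (fun _ : Λ => uniformSphere (volume : Measure E))) /
        ∫ ω, Real.exp (-(s * S (fun m => ((ω : Λ → sphere (0 : E) 1) m : E))))
          ∂Measure.pi (fun _ : Λ => uniformSphere (volume : Measure E)) :=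
    div_nonneg (integral_nonneg fun ω => mul_nonneg (hwpos ω).le (hV0 ω)) hZ.le
  have hVbarM : (∫ ω, Real.exp (-(s * S (fun m => ((ω : Λ → sphere (0 : E) 1) m : E)))) * V ω
      ∂Measure.pi (fun _ : Λ => uniformSphere (volume : Measure E))) /
        ∫ ω, Real.exp (-(s * S (fun m => ((ω : Λ → sphere (0 : E) 1) m : E))))
          ∂Measure.pi (fun _ : Λ => uniformSphere (volume : Measure E)) ≤ MV := by
    rw [div_le_iff₀ hZ, ← integral_const_mul]
    refine integral_mono (integrable_pi_of_continuous _ (hw.mul hV))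
      (integrable_pi_of_continuous _ (continuous_const.mul hw)) fun ω => ?_
    dsimp only
    calc Real.exp (-(s * S (fun m => (ω m : E)))) * V ω
        ≤ Real.exp (-(s * S (fun m => (ω m : E)))) * MV := mul_le_mul_of_nonneg_left (hVb ω) (hwpos ω).le
      _ = MV * Real.exp (-(s * S (fun m => (ω m : E)))) := mul_comm _ _
  -- abbreviate the tilted mean of V
  set Vbar : ℝ := (∫ ω, Real.exp (-(s * S (fun m => ((ω : Λ → sphere (0 : E) 1) m : E)))) * V ω
      ∂Measure.pi (fun _ : Λ => uniformSphere (volume : Measure E))) /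
        ∫ ω, Real.exp (-(s * S (fun m => ((ω : Λ → sphere (0 : E) 1) m : E))))
          ∂Measure.pi (fun _ : Λ => uniformSphere (volume : Measure E)) with hVbar
  have hiKV : Integrable (fun ω : Λ → sphere (0 : E) 1 =>
      Real.exp (-(s * S (fun m => (ω m : E)))) * K ω * V ω)
      (Measure.pi fun _ : Λ => uniformSphere (volume : Measure E)) :=
    integrable_pi_of_continuous _ ((hw.mul hK).mul hV)
  have hiK : Integrable (fun ω : Λ → sphere (0 : E) 1 => Real.exp (-(s * S (fun m => (ω m : E)))) * K ω)
      (Measure.pi fun _ : Λ => uniformSphere (volume : Measure E)) :=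
    integrable_pi_of_continuous _ (hw.mul hK)
  -- Cov = (1/Z) ∫ w K (V − Vbar)
  have e : ∫ ω, Real.exp (-(s * S (fun m => ((ω : Λ → sphere (0 : E) 1) m : E)))) * K ω * (V ω - Vbar)
      ∂Measure.pi (fun _ : Λ => uniformSphere (volume : Measure E)) =
      (∫ ω, Real.exp (-(s * S (fun m => ((ω : Λ → sphere (0 : E) 1) m : E)))) * K ω * V ω
        ∂Measure.pi (fun _ : Λ => uniformSphere (volume : Measure E))) -
        Vbar * ∫ ω, Real.exp (-(s * S (fun m => ((ω : Λ → sphere (0 : E) 1) m : E)))) * K ω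
          ∂Measure.pi (fun _ : Λ => uniformSphere (volume : Measure E)) := by
    rw [← integral_const_mul, ← integral_sub hiKV (hiK.const_mul Vbar)]
    refine integral_congr_ae (ae_of_all _ fun ω => ?_)
    ring
  have key : ∀ A B Z : ℝ, Z ≠ 0 → B / Z - A / Z * Vbar = (B - Vbar * A) / Z := by
    intro A B Z hZ0
    rw [div_mul_eq_mul_div, ← sub_div, mul_comm A Vbar]
  rw [key _ _ _ hZ.ne', ← e, abs_div, abs_of_pos hZ, div_le_iff₀ hZ]
  -- |∫ w K (V − Vbar)| ≤ ∫ MK · MV · w = MK MV Z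
  have hbound : ∀ ω : Λ → sphere (0 : E) 1,
      ‖Real.exp (-(s * S (fun m => (ω m : E)))) * K ω * (V ω - Vbar)‖ ≤
        MK * MV * Real.exp (-(s * S (fun m => (ω m : E)))) := fun ω => by
    rw [Real.norm_eq_abs, abs_mul, abs_mul, abs_of_pos (hwpos ω)]
    have hMK : 0 ≤ MK := (abs_nonneg _).trans (hKb ω)
    have hVd : |V ω - Vbar| ≤ MV := by
      rw [abs_le]; constructor <;> linarith [hV0 ω, hVb ω]
    have h1 : Real.exp (-(s * S (fun m => (ω m : E)))) * |K ω| ≤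
        Real.exp (-(s * S (fun m => (ω m : E)))) * MK := mul_le_mul_of_nonneg_left (hKb ω) (hwpos ω).le
    calc Real.exp (-(s * S (fun m => (ω m : E)))) * |K ω| * |V ω - Vbar|
        ≤ Real.exp (-(s * S (fun m => (ω m : E)))) * MK * MV :=
          mul_le_mul h1 hVd (abs_nonneg _) (mul_nonneg (hwpos ω).le hMK)
      _ = MK * MV * Real.exp (-(s * S (fun m => (ω m : E)))) := by ring
  have h := norm_integral_le_of_norm_le (hiw.const_mul (MK * MV)) (ae_of_all _ hbound)
  rw [integral_const_mul, Real.norm_eq_abs] at h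
  exact h

/-- **THE SECOND-ORDER DEFECT OF THE LEADING-ORDER MAP.**  Let `S = esAction κ S₀ U` (no
self-coupling, adjoint pairs, `d ≥ 2`), `Φ` its leading-order flow (gradient flow of `S̃⁽⁰⁾`),
`0 ≤ c`, `H ∈ C¹` with `|H| ≤ M_H` on `Ω`, and `V₀ = (2κ²/(d−1))Σ_n‖p_n‖² ≤ M_V` on `Ω`.  Then
`|∫e^{−cS}H dπ̄ / ∫e^{−cS}dπ̄ − ∫ H(Φ_c ω) dπ̄(ω)| ≤ (c²/2)·M_H·M_V`:
THE LAW TRANSPORTED BY THE LO FLOW AGREES WITH THE TILTED MEASURE `e^{−cS}π̄/Z_c` TO SECOND ORDER IN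
THE FLOW TIME, with an explicit constant. -/
theorem abs_tiltedMean_sub_integral_comp_loFlow_le (hU0 : ∀ n, U n n = 0)
    (hUadj : ∀ m n (v w : E), ⟪U m n v, w⟫ = ⟪v, U n m w⟫) (hd : 2 ≤ Module.finrank ℝ E)
    (κ S₀ : ℝ) {H : (Λ → E) → ℝ} (hH : ContDiff ℝ 1 H) {c : ℝ} (hc : 0 ≤ c) {MH MV : ℝ}
    (hHb : ∀ ω : Λ → sphere (0 : E) 1, |H (fun m => (ω m : E))| ≤ MH)
    (hVb : ∀ ω : Λ → sphere (0 : E) 1, 2 * κ ^ 2 / ((Module.finrank ℝ E : ℝ) - 1) *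
      ∑ n, ‖tangentKick (localField U n (fun m => (ω m : E))) ((fun m => (ω m : E)) n)‖ ^ 2 ≤ MV) :
    |(∫ ω, Real.exp (-(c * esAction κ S₀ U (fun m => ((ω : Λ → sphere (0 : E) 1) m : E)))) *
          H (fun m => (ω m : E)) ∂Measure.pi (fun _ : Λ => uniformSphere (volume : Measure E))) /
          (∫ ω, Real.exp (-(c * esAction κ S₀ U (fun m => ((ω : Λ → sphere (0 : E) 1) m : E))))
            ∂Measure.pi (fun _ : Λ => uniformSphere (volume : Measure E))) -
        ∫ ω, H (sphereGradientFlow (contDiff_loFlowAction U κ S₀)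
          (fun m => ((ω : Λ → sphere (0 : E) 1) m : E)) c)
            ∂Measure.pi (fun _ : Λ => uniformSphere (volume : Measure E))| ≤
      c ^ 2 / 2 * MH * MV := by
  have hS : ContDiff ℝ 1 (esAction κ S₀ U) := contDiff_esAction U κ S₀
  have hG : ContDiff ℝ 2 (loFlowAction κ S₀ U) := contDiff_loFlowAction U κ S₀
  -- the tilted mean of the transported observable, as a function of the initial time `s`
  set g : ℝ → ℝ := fun s =>
    (∫ ω, Real.exp (-(s * esAction κ S₀ U (fun m => ((ω : Λ → sphere (0 : E) 1) m : E)))) *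
        H (sphereGradientFlow hG (fun m => (ω m : E)) (c - s))
          ∂Measure.pi (fun _ : Λ => uniformSphere (volume : Measure E))) /
      ∫ ω, Real.exp (-(s * esAction κ S₀ U (fun m => ((ω : Λ → sphere (0 : E) 1) m : E))))
        ∂Measure.pi (fun _ : Λ => uniformSphere (volume : Measure E)) with hg
  -- its derivative `s · Cov_s`
  set cov : ℝ → ℝ := fun s =>
    (∫ ω, Real.exp (-(s * esAction κ S₀ U (fun m => ((ω : Λ → sphere (0 : E) 1) m : E)))) *
          H (sphereGradientFlow hG (fun m => (ω m : E)) (c - s)) *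
            (2 * κ ^ 2 / ((Module.finrank ℝ E : ℝ) - 1) *
              ∑ n, ‖tangentKick (localField U n (fun m => (ω m : E))) ((fun m => (ω m : E)) n)‖ ^ 2)
        ∂Measure.pi (fun _ : Λ => uniformSphere (volume : Measure E))) /
        (∫ ω, Real.exp (-(s * esAction κ S₀ U (fun m => ((ω : Λ → sphere (0 : E) 1) m : E))))
          ∂Measure.pi (fun _ : Λ => uniformSphere (volume : Measure E))) -
      (∫ ω, Real.exp (-(s * esAction κ S₀ U (fun m => ((ω : Λ → sphere (0 : E) 1) m : E)))) *
          H (sphereGradientFlow hG (fun m => (ω m : E)) (c - s))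
        ∂Measure.pi (fun _ : Λ => uniformSphere (volume : Measure E))) /
        (∫ ω, Real.exp (-(s * esAction κ S₀ U (fun m => ((ω : Λ → sphere (0 : E) 1) m : E))))
          ∂Measure.pi (fun _ : Λ => uniformSphere (volume : Measure E))) *
      ((∫ ω, Real.exp (-(s * esAction κ S₀ U (fun m => ((ω : Λ → sphere (0 : E) 1) m : E)))) *
            (2 * κ ^ 2 / ((Module.finrank ℝ E : ℝ) - 1) *
              ∑ n, ‖tangentKick (localField U n (fun m => (ω m : E))) ((fun m => (ω m : E)) n)‖ ^ 2)
          ∂Measure.pi (fun _ : Λ => uniformSphere (volume : Measure E))) /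
        ∫ ω, Real.exp (-(s * esAction κ S₀ U (fun m => ((ω : Λ → sphere (0 : E) 1) m : E))))
          ∂Measure.pi (fun _ : Λ => uniformSphere (volume : Measure E))) with hcov
  have hderiv : ∀ s, HasDerivAt g (s * cov s) s := fun s =>
    hasDerivAt_tiltedMean_comp_loFlow hU0 hUadj hd κ S₀ hH c s
  -- `|cov s| ≤ MH · MV`
  have hcovb : ∀ s, |cov s| ≤ MH * MV := fun s => by
    have hcK : Continuous fun ω : Λ → sphere (0 : E) 1 =>
        H (sphereGradientFlow hG (fun m => (ω m : E)) (c - s)) :=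
      (hH.continuous.comp (continuous_sphereGradientFlow hG (c - s))).comp continuous_sphereConfig
    have hcV : Continuous fun ω : Λ → sphere (0 : E) 1 =>
        2 * κ ^ 2 / ((Module.finrank ℝ E : ℝ) - 1) *
          ∑ n, ‖tangentKick (localField U n (fun m => (ω m : E))) ((fun m => (ω m : E)) n)‖ ^ 2 :=
      continuous_const.mul (continuous_sum_norm_tangentKick_sq_sphereConfig U)
    exact abs_tiltedCov_le hS.continuous s hcK hcV (fun ω => hHb (sphereFlowMap hG (c - s) ω))
      (fun ω => (loCarre_le U hd κ (norm_sphereConfig_eq_one ω)).1) hVb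
  -- `g ∓ (MH·MV/2)s²` are monotone on `[0, c]`
  have hsq : ∀ s : ℝ, HasDerivAt (fun y : ℝ => MH * MV / 2 * (y * y)) (MH * MV * s) s := fun s => by
    have h := ((hasDerivAt_id s).mul (hasDerivAt_id s)).const_mul (MH * MV / 2)
    refine h.congr_deriv ?_
    simp only [id]
    ring
  have hφ : AntitoneOn (fun s => g s - MH * MV / 2 * (s * s)) (Icc 0 c) := by
    refine antitoneOn_of_hasDerivWithinAt_nonpos (convex_Icc 0 c)
      (f' := fun s => s * cov s - MH * MV * s)
      (fun s _ => ((hderiv s).sub (hsq s)).continuousAt.continuousWithinAt)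
      (fun s _ => ((hderiv s).sub (hsq s)).hasDerivWithinAt) fun s hs => ?_
    rw [interior_Icc] at hs
    have h1 : s * cov s ≤ s * (MH * MV) :=
      mul_le_mul_of_nonneg_left ((le_abs_self _).trans (hcovb s)) hs.1.le
    linarith [h1]
  have hψ : MonotoneOn (fun s => g s + MH * MV / 2 * (s * s)) (Icc 0 c) := by
    refine monotoneOn_of_hasDerivWithinAt_nonneg (convex_Icc 0 c)
      (f' := fun s => s * cov s + MH * MV * s)
      (fun s _ => ((hderiv s).add (hsq s)).continuousAt.continuousWithinAt)
      (fun s _ => ((hderiv s).add (hsq s)).hasDerivWithinAt) fun s hs => ?_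
    rw [interior_Icc] at hs
    have h1 : -(s * (MH * MV)) ≤ s * cov s := by
      have h2 : s * -(MH * MV) ≤ s * cov s :=
        mul_le_mul_of_nonneg_left ((neg_le.2 ((neg_le_abs _).trans (hcovb s)))) hs.1.le
      linarith [h2]
    linarith [h1]
  have h0c : (0 : ℝ) ∈ Icc 0 c := ⟨le_rfl, hc⟩
  have hcc : c ∈ Icc 0 c := ⟨hc, le_rfl⟩
  have hup := hφ h0c hcc hc
  have hlo := hψ h0c hcc hc
  simp only [mul_zero, sub_zero, add_zero] at hup hlo
  -- identify `g c` and `g 0`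
  have hgc' : g c = (∫ ω, Real.exp (-(c * esAction κ S₀ U (fun m => ((ω : Λ → sphere (0 : E) 1) m : E)))) *
        H (fun m => (ω m : E)) ∂Measure.pi (fun _ : Λ => uniformSphere (volume : Measure E))) /
      ∫ ω, Real.exp (-(c * esAction κ S₀ U (fun m => ((ω : Λ → sphere (0 : E) 1) m : E))))
        ∂Measure.pi (fun _ : Λ => uniformSphere (volume : Measure E)) := by
    simp only [hg, sub_self, sphereGradientFlow_zero]
  have hg0 : g 0 = ∫ ω, H (sphereGradientFlow hG (fun m => ((ω : Λ → sphere (0 : E) 1) m : E)) c)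
      ∂Measure.pi (fun _ : Λ => uniformSphere (volume : Measure E)) := by
    simp only [hg, zero_mul, neg_zero, Real.exp_zero, one_mul, sub_zero, integral_const, smul_eq_mul,
      mul_one, probReal_univ, div_one]
  rw [← hgc', ← hg0, abs_le, pow_two]
  constructor <;> nlinarith [hup, hlo]

/-- **THE DEFECT WITH THE EXPLICIT VOLUME BOUND**: under the same hypotheses with only `|H| ≤ M_H`
assumed, `|∫e^{−cS}H dπ̄/∫e^{−cS}dπ̄ − ∫H(Φ_c ω)dπ̄(ω)| ≤ (c²/2)·M_H·(2κ²/(d−1))·Σ_n(Σ_m‖U_nm‖)²` —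
for unit-norm nearest-neighbour transporters with coordination number `z` the last factor is
`z²·|Λ|`: the bias of the uncorrected LO map is `O(c²·|Λ|)`. -/
theorem abs_tiltedMean_sub_integral_comp_loFlow_le_volume (hU0 : ∀ n, U n n = 0)
    (hUadj : ∀ m n (v w : E), ⟪U m n v, w⟫ = ⟪v, U n m w⟫) (hd : 2 ≤ Module.finrank ℝ E)
    (κ S₀ : ℝ) {H : (Λ → E) → ℝ} (hH : ContDiff ℝ 1 H) {c : ℝ} (hc : 0 ≤ c) {MH : ℝ}
    (hHb : ∀ ω : Λ → sphere (0 : E) 1, |H (fun m => (ω m : E))| ≤ MH) :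
    |(∫ ω, Real.exp (-(c * esAction κ S₀ U (fun m => ((ω : Λ → sphere (0 : E) 1) m : E)))) *
          H (fun m => (ω m : E)) ∂Measure.pi (fun _ : Λ => uniformSphere (volume : Measure E))) /
          (∫ ω, Real.exp (-(c * esAction κ S₀ U (fun m => ((ω : Λ → sphere (0 : E) 1) m : E))))
            ∂Measure.pi (fun _ : Λ => uniformSphere (volume : Measure E))) -
        ∫ ω, H (sphereGradientFlow (contDiff_loFlowAction U κ S₀)
          (fun m => ((ω : Λ → sphere (0 : E) 1) m : E)) c)
            ∂Measure.pi (fun _ : Λ => uniformSphere (volume : Measure E))| ≤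
      c ^ 2 / 2 * MH * (2 * κ ^ 2 / ((Module.finrank ℝ E : ℝ) - 1) * ∑ n, (∑ m, ‖U n m‖) ^ 2) :=
  abs_tiltedMean_sub_integral_comp_loFlow_le hU0 hUadj hd κ S₀ hH hc hHb fun ω =>
    (loCarre_le U hd κ (norm_sphereConfig_eq_one ω)).2

end Defect

end Summit.Ventures.LatticeQCDFlow.Exactness

end
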